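import Summits.BirchSwinnertonDyer.BirchSwinnertonDyer.Theorems.AlignedTransportAtTwoMainConjectureOfRankZeroBSDAtTwoSexticTowerGrowth
import Literature.NumberTheory.NumberFields.NormRelationSymmetricThree
import Literature.NumberTheory.IwasawaTheory.ClassicalMuVanishesIffBoundedRank
import Literature.NumberTheory.IwasawaTheory.ClassicalMuVanishesNormRelationTower
import Literature.NumberTheory.IwasawaTheory.ClassicalMuVanishesKleinDescent
import Literature.NumberTheory.IwasawaTheory.ClassicalMuVanishesQuadraticAscentSqrtOdd
import Literature.NumberTheory.IwasawaTheory.ClassicalMuVanishesCyclicAscentOddRat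
import Literature.NumberTheory.IwasawaTheory.ClassicalMuVanishesFiniteDescent
import HarnessLib

/-!
# Route `AlignedTransportAtTwo`, crux C2 `MainConjectureOfRankZeroBSDAtTwo` (stmt-BirchSwinnertonDyer-22298):
# THE `S₃` NORM-RELATION DESCENT AT `p = 2` — `e_n(ℚ(W[2])) ≤ 3·e_n(ℚ(β)) + e_n(ℚ(√Δ_W)) + e_n(ℚ)` along the cyclotomic `ℤ₂`-towers,
# hence `μ₂(ℚ(W[2])^{cyc}) = 0` ⟸ `μ₂(ℚ(β)^{cyc}) = 0 ∧ μ₂(ℚ(√Δ_W)^{cyc}) = 0`, in the KERNEL (no Iwasawa 1973)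

HONEST FRAMING (cell `bsd-f1-sign2`, WIDTH-5 attached prover seat `bsd-line-att-p4` gen 28 on line `birth` of the lead `bsd-line-att-p2`;
`--supports` stmt-BirchSwinnertonDyer-22298, closes nothing; BSD is NOT proved by any of this; crux C2, its verdict «blocked-on
`Rank1Residual.GreenbergMuConjectureIrreducible`» and every registered stub untouched). THEOREMS ONLY.

WHAT. For an elliptic `W/ℚ` with no rational `2`-torsion abscissa and `Δ_W < 0` let `T = ℚ(W[2])` (`[T:ℚ] = 6`, totally complex,
`Gal(T/ℚ) ≅ S₃`: att-p3 g26 `…SexticTowerGrowth`). §1: the three cubic subfields `ℚ(β_j)` have fixing subgroups `H_j` of order `2`, pairwise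
distinct; the resolvent `ℚ(4δ₀)`, `(4δ₀)² = Δ_W`, has fixing subgroup `C` of order `3`. §2: this seat's Literature identity
`NormRelation.normRelation_card_six` (`3 = N_{H₁} + N_{H₂} + N_{H₃} + N_C − N_G` in `ℤ[Gal(T/ℚ)]`, Biasse–Fieker–Hofmann–Page 2022 Def. 2.1,
ODD denominator). §3: `T ∩ ℚ_∞ = ℚ` (`T = ℚ(β)(√Δ_W)`, `ℚ(β)` of odd degree, `T` totally complex: tree
`surjective_comp_absGaloisRestrict_of_sq_eq_of_isTotallyComplex`). §4: cell `bsd-potss`'s tower machinery (BFHP Prop. 3.7 per layer,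
`IwasawaTheory.classNumberPExp_restrict_le_sum_of_normRelation`) gives, for EVERY `n` and every cyclotomic `ℤ₂`-extension of `T`,
  **`e_n(T) ≤ e_n(ℚ(β₀)) + e_n(ℚ(β₁)) + e_n(ℚ(β₂)) + e_n(ℚ(√Δ_W)) + e_n(ℚ)`**, `e_n(ℚ) = 0` (tree, Iwasawa 1956),
hence ★ `classNumberPExp_divisionField_two_eq_zero_of_cubic_of_resolvent` (all three towers `2`-class-number free ⟹ so is `T`'s) and
★ `classicalMuVanishes_divisionField_two_of_cubic_of_resolvent` (`μ₂ = 0` for the cubic and the resolvent towers ⟹ `μ₂(T^{cyc}) = 0`).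
The SEXTIC is Lim's natural carrier (`E[2] ⊆ E(T)`); the crux line's PFμ⁺ docstring reached it from the cubic only «modulo CFT print [Iw73]»
— this file removes that print dependence for the sextic (not for `ℚ(W[2], i)`). CONDITIONAL only on the displayed tower inputs; nothing closed.

References: [BiasseEtAl2022] Def. 2.1, Prop. 3.7; [Washington1997] §13.1, Prop. 13.22; [NeukirchANT1999] III (1.6); tree: `…SexticTowerGrowth` (att-p3 g26),
`Literature/…/NormRelationSymmetricThree` (this seat), `ClassGroupNormRelations`, `ClassicalMuVanishesNormRelationTower`, `…IffBoundedRank`,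
`…KleinDescent`, `…QuadraticAscentSqrtOdd`, `…CyclicAscentOddRat` (cell bsd-potss).
-/

set_option linter.dupNamespace false
set_option autoImplicit false

noncomputable section

open scoped Classical NumberField

namespace Summit.BirchSwinnertonDyer.BirchSwinnertonDyer.Theorems.AlignedTransportAtTwoSexticNormRelationDescent

open NumberField Polynomial WeierstrassCurve IntermediateField Field
  Literature.NumberTheory.EllipticCurves Literature.NumberTheory.EllipticCurves.Greenberg1999
  Literature.NumberTheory.EllipticCurves.DokchitserDokchitser2012
  Literature.NumberTheory.EllipticCurves.ZpExtension Literature.NumberTheory.GaloisRepresentations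
  Literature.NumberTheory.IwasawaTheory Literature.NumberTheory.NumberFields
  Summit.BirchSwinnertonDyer.BirchSwinnertonDyer.Theorems.AlignedTransportAtTwoFineRoad.DivisionCubic
  Summit.BirchSwinnertonDyer.BirchSwinnertonDyer.Theorems.AlignedTransportAtTwoFineRoad.TowerImageDelta
  Summit.BirchSwinnertonDyer.BirchSwinnertonDyer.Theorems.AlignedTransportAtTwoCubicClosureParity
  Summit.BirchSwinnertonDyer.BirchSwinnertonDyer.Theorems.AlignedTransportAtTwoSexticTowerGrowth

variable (W : WeierstrassCurve ℚ) [W.IsElliptic]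

/-! ## §1 The Galois group of `T = ℚ(W[2])`: order `6`, three subgroups of order `2` (the cubic subfields), one of order `3` (the resolvent) -/

/-- The root `β_j ∈ T` (`j = 0, 1, 2`) of the `2`-division cubic. [cite: SilvermanAEC2009, III.§1] -/
theorem xT_mem (j : Fin 3) : xT W two_ne_zero j ∈ W.divisionField 2 := xT_mem_divisionField W two_ne_zero j

/-- `δ = 4δ₀ ∈ T` with `δ² = Δ_W`. [cite: DokchitserDokchitserMathZ2012, Theorem (1), proof (ℚ(E[2]) ⊃ ℚ(√Δ))] -/
theorem delta_mem_and_sq : 4 * delta W two_ne_zero ∈ W.divisionField 2 ∧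
    (4 * delta W two_ne_zero) ^ 2 = ((W.Δ : ℚ) : AlgebraicClosure ℚ) := by
  have h2 : (2 : ℚ) ≠ 0 := two_ne_zero
  refine ⟨?_, ?_⟩
  · have hd : delta W h2 ∈ W.divisionField 2 := by
      change (xT W h2 0 - xT W h2 1) * (xT W h2 0 - xT W h2 2) * (xT W h2 1 - xT W h2 2) ∈ W.divisionField 2
      exact mul_mem (mul_mem (sub_mem (xT_mem_divisionField W h2 0) (xT_mem_divisionField W h2 1))
        (sub_mem (xT_mem_divisionField W h2 0) (xT_mem_divisionField W h2 2)))
        (sub_mem (xT_mem_divisionField W h2 1) (xT_mem_divisionField W h2 2))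
    exact mul_mem (ofNat_mem _ 4) hd
  · have h16 := sixteen_mul_delta_sq W h2
    rw [eq_ratCast] at h16
    rw [← h16]; ring

omit [W.IsElliptic] in
/-- The minimal polynomial over `ℚ` of an element of `T` is that of its image in `ℚ̄`. [folklore] -/
theorem minpoly_coe (x : W.divisionField 2) : minpoly ℚ x = minpoly ℚ (x : AlgebraicClosure ℚ) :=
  (minpoly.algebraMap_eq (algebraMap (W.divisionField 2) (AlgebraicClosure ℚ)).injective x).symm

/-- `[ℚ(β_j) : ℚ] = 3` inside `T` (the `2`-division cubic is irreducible). [cite: SilvermanAEC2009, III.2.3 (b)] -/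
theorem finrank_adjoin_xT (ht : ∀ x : ℚ, ¬ HasRationalTwoTorsionX W x) (j : Fin 3) :
    Module.finrank ℚ ℚ⟮(⟨xT W two_ne_zero j, xT_mem W j⟩ : W.divisionField 2)⟯ = 3 := by
  have h2 : (2 : ℚ) ≠ 0 := two_ne_zero
  set b : W.divisionField 2 := ⟨xT W h2 j, xT_mem W j⟩
  have hirr := AlignedTransportAtTwoSeed.irr_two_of_forall_not_hasRationalTwoTorsionX W ht
  have hβ : aeval (xT W h2 j) W.twoTorsionPolynomial.toPoly = 0 :=
    (mem_rootSet_of_ne (twoTorsionPolynomial_toPoly_ne_zero W h2)).mp (xT_mem_rootSet W h2 j)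
  have h3 := AddKatoTwo.finrank_adjoin_root_twoTorsionPolynomial_eq_three W hirr hβ
  have hint : IsIntegral ℚ b := IsIntegral.of_finite ℚ b
  have hint' : IsIntegral ℚ (xT W h2 j) := ((AlgebraicClosure.isAlgebraic ℚ).isAlgebraic _).isIntegral
  rw [IntermediateField.adjoin.finrank hint, minpoly_coe W b]
  show (minpoly ℚ (xT W h2 j)).natDegree = 3
  rw [← IntermediateField.adjoin.finrank hint']
  exact h3

/-- `[ℚ(δ) : ℚ] = 2` inside `T` (`δ² = Δ_W < 0` is not a square). [cite: DokchitserDokchitserMathZ2012, Theorem (1)] -/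
theorem finrank_adjoin_delta (hΔ : W.Δ < 0) :
    Module.finrank ℚ ℚ⟮(⟨4 * delta W two_ne_zero, (delta_mem_and_sq W).1⟩ : W.divisionField 2)⟯ = 2 := by
  have hsq : ¬ IsSquare W.Δ := fun ⟨r, hr⟩ ↦ by nlinarith [mul_self_nonneg r]
  refine finrank_adjoin_eq_two_of_sq_eq (q := W.Δ) ?_ hsq
  apply (algebraMap (W.divisionField 2) (AlgebraicClosure ℚ)).injective
  rw [map_pow, map_ratCast]
  exact (delta_mem_and_sq W).2

/-- `|Gal(T/ℚ)| = 6`. [cite: SilvermanAEC2009, III.§1] -/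
theorem natCard_gal (ht : ∀ x : ℚ, ¬ HasRationalTwoTorsionX W x) (hΔ : W.Δ < 0) :
    Nat.card (W.divisionField 2 ≃ₐ[ℚ] W.divisionField 2) = 6 := by
  haveI : IsGalois ℚ (W.divisionField 2) := W.isGalois_divisionField 2
  have hsq : ¬ IsSquare W.Δ := fun ⟨r, hr⟩ ↦ by nlinarith [mul_self_nonneg r]
  rw [IsGalois.card_aut_eq_finrank, finrank_divisionField_two_eq_six W ht hsq]

/-- The fixing subgroup of `ℚ(β_j) ⊆ T` has order `2` (`[T : ℚ(β_j)] = 6/3`). [cite: MilneFT2022, Ch. 3 (fundamental theorem)] -/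
theorem natCard_fixingSubgroup_adjoin_xT (ht : ∀ x : ℚ, ¬ HasRationalTwoTorsionX W x) (hΔ : W.Δ < 0) (j : Fin 3) :
    Nat.card (ℚ⟮(⟨xT W two_ne_zero j, xT_mem W j⟩ : W.divisionField 2)⟯.fixingSubgroup) = 2 := by
  haveI : IsGalois ℚ (W.divisionField 2) := W.isGalois_divisionField 2
  have hsq : ¬ IsSquare W.Δ := fun ⟨r, hr⟩ ↦ by nlinarith [mul_self_nonneg r]
  set E := ℚ⟮(⟨xT W two_ne_zero j, xT_mem W j⟩ : W.divisionField 2)⟯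
  rw [IsGalois.card_fixingSubgroup_eq_finrank E]
  have htower := Module.finrank_mul_finrank ℚ E (W.divisionField 2)
  rw [finrank_adjoin_xT W ht j, finrank_divisionField_two_eq_six W ht hsq] at htower
  omega

/-- The fixing subgroup of `ℚ(δ) ⊆ T` has order `3` (`[T : ℚ(δ)] = 6/2`). [cite: MilneFT2022, Ch. 3 (fundamental theorem)] -/
theorem natCard_fixingSubgroup_adjoin_delta (ht : ∀ x : ℚ, ¬ HasRationalTwoTorsionX W x) (hΔ : W.Δ < 0) :
    Nat.card (ℚ⟮(⟨4 * delta W two_ne_zero, (delta_mem_and_sq W).1⟩ : W.divisionField 2)⟯.fixingSubgroup) = 3 := by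
  haveI : IsGalois ℚ (W.divisionField 2) := W.isGalois_divisionField 2
  have hsq : ¬ IsSquare W.Δ := fun ⟨r, hr⟩ ↦ by nlinarith [mul_self_nonneg r]
  set D := ℚ⟮(⟨4 * delta W two_ne_zero, (delta_mem_and_sq W).1⟩ : W.divisionField 2)⟯
  rw [IsGalois.card_fixingSubgroup_eq_finrank D]
  have htower := Module.finrank_mul_finrank ℚ D (W.divisionField 2)
  rw [finrank_adjoin_delta W hΔ, finrank_divisionField_two_eq_six W ht hsq] at htower
  omega

/-- **Vieta in `T`**: `β₀ + β₁ + β₂ = −b₂/4`. [cite: SilvermanAEC2009, III.§1] -/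
theorem xT_sum :
    ((⟨xT W two_ne_zero 0, xT_mem W 0⟩ : W.divisionField 2) + ⟨xT W two_ne_zero 1, xT_mem W 1⟩ + ⟨xT W two_ne_zero 2, xT_mem W 2⟩ : W.divisionField 2) =
      algebraMap ℚ (W.divisionField 2) (-(W.b₂ / 4)) := by
  have h2 : (2 : ℚ) ≠ 0 := two_ne_zero
  apply (algebraMap (W.divisionField 2) (AlgebraicClosure ℚ)).injective
  rw [map_add, map_add, ← IsScalarTower.algebraMap_apply]
  change xT W h2 0 + xT W h2 1 + xT W h2 2 = algebraMap ℚ (AlgebraicClosure ℚ) (-(W.b₂ / 4))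
  -- the cubic splits in `ℚ̄` with roots `{x, y, z}`, and `{β₀, β₁, β₂}` is that multiset
  set P : Cubic ℚ := W.twoTorsionPolynomial with hP
  have ha : P.a ≠ 0 := by simp [hP, WeierstrassCurve.twoTorsionPolynomial]
  have hsplit : (P.toPoly.map (algebraMap ℚ (AlgebraicClosure ℚ))).Splits := IsAlgClosed.splits _
  obtain ⟨x, y, z, hroots⟩ := (Cubic.splits_iff_roots_eq_three ha).mp hsplit
  have hb := Cubic.b_eq_three_roots ha hroots
  have hne : (P.toPoly.map (algebraMap ℚ (AlgebraicClosure ℚ))) ≠ 0 :=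
    Polynomial.map_ne_zero (twoTorsionPolynomial_toPoly_ne_zero W h2)
  have hmem : ∀ j : Fin 3, xT W h2 j ∈ (Cubic.map (algebraMap ℚ (AlgebraicClosure ℚ)) P).roots := by
    intro j
    rw [Cubic.map_roots, Polynomial.mem_roots hne, Polynomial.IsRoot.def, Polynomial.eval_map, ← Polynomial.aeval_def]
    exact (mem_rootSet_of_ne (twoTorsionPolynomial_toPoly_ne_zero W h2)).mp (xT_mem_rootSet W h2 j)
  have hinj := xT_injective W h2
  have h01 : xT W h2 0 ≠ xT W h2 1 := hinj.ne (by decide)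
  have h02 : xT W h2 0 ≠ xT W h2 2 := hinj.ne (by decide)
  have h12 : xT W h2 1 ≠ xT W h2 2 := hinj.ne (by decide)
  have hnodup : ({xT W h2 0, xT W h2 1, xT W h2 2} : Multiset (AlgebraicClosure ℚ)).Nodup := by
    simp [h01, h02, h12]
  have hle : ({xT W h2 0, xT W h2 1, xT W h2 2} : Multiset (AlgebraicClosure ℚ)) ≤
      (Cubic.map (algebraMap ℚ (AlgebraicClosure ℚ)) P).roots := by
    rw [Multiset.le_iff_subset hnodup]
    intro t ht
    simp only [Multiset.insert_eq_cons, Multiset.mem_cons, Multiset.mem_singleton] at ht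
    rcases ht with rfl | rfl | rfl <;> exact hmem _
  have hcard : Multiset.card (Cubic.map (algebraMap ℚ (AlgebraicClosure ℚ)) P).roots ≤
      Multiset.card ({xT W h2 0, xT W h2 1, xT W h2 2} : Multiset (AlgebraicClosure ℚ)) := by
    rw [hroots]; simp
  have heq := Multiset.eq_of_le_of_card_le hle hcard
  have hsum : xT W h2 0 + xT W h2 1 + xT W h2 2 = x + y + z := by
    have := congrArg Multiset.sum heq
    rw [hroots] at this
    simpa [add_assoc] using this
  rw [hsum]
  have hb' : algebraMap ℚ (AlgebraicClosure ℚ) W.b₂ = algebraMap ℚ (AlgebraicClosure ℚ) 4 * -(x + y + z) := by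
    simpa [hP, WeierstrassCurve.twoTorsionPolynomial] using hb
  rw [map_neg, map_div₀]
  have h4 : algebraMap ℚ (AlgebraicClosure ℚ) 4 ≠ 0 := by rw [map_ofNat]; norm_num
  field_simp
  rw [hb']; ring

/-- An intermediate field of `T` containing two of the roots contains the third, hence `δ`. [cite: SilvermanAEC2009, III.§1] -/
theorem delta_mem_of_mem_of_mem (E : IntermediateField ℚ (W.divisionField 2)) {i j : Fin 3} (hij : i ≠ j)
    (hi : (⟨xT W two_ne_zero i, xT_mem W i⟩ : W.divisionField 2) ∈ E) (hj : (⟨xT W two_ne_zero j, xT_mem W j⟩ : W.divisionField 2) ∈ E) :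
    (⟨4 * delta W two_ne_zero, (delta_mem_and_sq W).1⟩ : W.divisionField 2) ∈ E := by
  have h2 : (2 : ℚ) ≠ 0 := two_ne_zero
  set b : Fin 3 → W.divisionField 2 := fun k ↦ ⟨xT W h2 k, xT_mem W k⟩ with hb
  have hsum : b 0 + b 1 + b 2 = algebraMap ℚ (W.divisionField 2) (-(W.b₂ / 4)) := xT_sum W
  have hc : algebraMap ℚ (W.divisionField 2) (-(W.b₂ / 4)) ∈ E := E.algebraMap_mem _
  -- all three roots lie in `E`: the third is `−b₂/4` minus the other two
  have hall : ∀ k : Fin 3, b k ∈ E := by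
    intro k
    by_cases hki : k = i
    · rw [hki]; exact hi
    by_cases hkj : k = j
    · rw [hkj]; exact hj
    have huniv : ({i, j, k} : Finset (Fin 3)) = Finset.univ := by
      apply Finset.eq_univ_of_card
      rw [Finset.card_insert_of_notMem (by simp [hij, Ne.symm hki]), Finset.card_insert_of_notMem (by simp [Ne.symm hkj]),
        Finset.card_singleton, Fintype.card_fin]
    have hs3 : ∑ m : Fin 3, b m = algebraMap ℚ (W.divisionField 2) (-(W.b₂ / 4)) := by rw [Fin.sum_univ_three]; exact hsum
    rw [← huniv, Finset.sum_insert (by simp [hij, Ne.symm hki]), Finset.sum_insert (by simp [Ne.symm hkj]), Finset.sum_singleton] at hs3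
    have hk : b k = algebraMap ℚ (W.divisionField 2) (-(W.b₂ / 4)) - b i - b j := by rw [← hs3]; ring
    rw [hk]
    exact sub_mem (sub_mem hc hi) hj
  have hδ : (⟨4 * delta W h2, (delta_mem_and_sq W).1⟩ : W.divisionField 2) = 4 * ((b 0 - b 1) * (b 0 - b 2) * (b 1 - b 2)) := by
    apply Subtype.ext
    simp only [hb]
    push_cast
    simp only [delta]
    norm_cast
  rw [hδ]
  exact mul_mem (ofNat_mem _ 4) (mul_mem (mul_mem (sub_mem (hall 0) (hall 1)) (sub_mem (hall 0) (hall 2))) (sub_mem (hall 1) (hall 2)))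

/-- `δ ∉ ℚ(β_j)` (degree `2 ∤ 3`), and hence no cubic subfield contains two roots. [cite: DokchitserDokchitserMathZ2012, Theorem (1)] -/
theorem delta_not_mem_adjoin_xT (ht : ∀ x : ℚ, ¬ HasRationalTwoTorsionX W x) (hΔ : W.Δ < 0) (j : Fin 3) :
    (⟨4 * delta W two_ne_zero, (delta_mem_and_sq W).1⟩ : W.divisionField 2) ∉
      ℚ⟮(⟨xT W two_ne_zero j, xT_mem W j⟩ : W.divisionField 2)⟯ := by
  intro hmem
  set E := ℚ⟮(⟨xT W two_ne_zero j, xT_mem W j⟩ : W.divisionField 2)⟯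
  set D := ℚ⟮(⟨4 * delta W two_ne_zero, (delta_mem_and_sq W).1⟩ : W.divisionField 2)⟯
  have hle : D ≤ E := adjoin_simple_le_iff.mpr hmem
  have htower := IntermediateField.finrank_bot_mul_relfinrank hle
  rw [finrank_adjoin_delta W hΔ, finrank_adjoin_xT W ht j] at htower
  omega

/-- **The three cubic subfields have pairwise distinct fixing subgroups** (equal subgroups ⟹ equal fixed fields ⟹ two roots in one cubic field
⟹ `δ` in it, `2 ∣ 3`). [cite: MilneFT2022, Ch. 3 (fundamental theorem)] -/
theorem fixingSubgroup_adjoin_xT_ne (ht : ∀ x : ℚ, ¬ HasRationalTwoTorsionX W x) (hΔ : W.Δ < 0) {i j : Fin 3} (hij : i ≠ j) :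
    (ℚ⟮(⟨xT W two_ne_zero i, xT_mem W i⟩ : W.divisionField 2)⟯).fixingSubgroup ≠
      (ℚ⟮(⟨xT W two_ne_zero j, xT_mem W j⟩ : W.divisionField 2)⟯).fixingSubgroup := by
  haveI : IsGalois ℚ (W.divisionField 2) := W.isGalois_divisionField 2
  intro heq
  have hE : ℚ⟮(⟨xT W two_ne_zero i, xT_mem W i⟩ : W.divisionField 2)⟯ = ℚ⟮(⟨xT W two_ne_zero j, xT_mem W j⟩ : W.divisionField 2)⟯ := by
    rw [← IsGalois.fixedField_fixingSubgroup ℚ⟮(⟨xT W two_ne_zero i, xT_mem W i⟩ : W.divisionField 2)⟯, heq,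
      IsGalois.fixedField_fixingSubgroup]
  have hi : (⟨xT W two_ne_zero i, xT_mem W i⟩ : W.divisionField 2) ∈ ℚ⟮(⟨xT W two_ne_zero i, xT_mem W i⟩ : W.divisionField 2)⟯ :=
    mem_adjoin_simple_self ℚ _
  have hj : (⟨xT W two_ne_zero j, xT_mem W j⟩ : W.divisionField 2) ∈ ℚ⟮(⟨xT W two_ne_zero i, xT_mem W i⟩ : W.divisionField 2)⟯ := by
    rw [hE]; exact mem_adjoin_simple_self ℚ _
  exact delta_not_mem_adjoin_xT W ht hΔ i (delta_mem_of_mem_of_mem W _ hij hi hj)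

/-! ## §2 The `S₃` norm relation in `ℤ[Gal(T/ℚ)]` (odd denominator `3`) -/

/-- **`3 = N_{H₀} + N_{H₁} + N_{H₂} + N_C − N_G` in `ℤ[Gal(ℚ(W[2])/ℚ)]`** (`H_j` the fixing subgroups of the cubic subfields, `C` that of the resolvent):
this seat's `NormRelation.normRelation_card_six` at the Galois group of order `6`. [cite: BiasseEtAl2022, Def. 2.1 and Prop. 3.7] -/
theorem normRelation_gal (ht : ∀ x : ℚ, ¬ HasRationalTwoTorsionX W x) (hΔ : W.Δ < 0)
    [hF : ∀ i, Fintype ↥((![(ℚ⟮(⟨xT W two_ne_zero 0, xT_mem W 0⟩ : W.divisionField 2)⟯).fixingSubgroup,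
      (ℚ⟮(⟨xT W two_ne_zero 1, xT_mem W 1⟩ : W.divisionField 2)⟯).fixingSubgroup,
      (ℚ⟮(⟨xT W two_ne_zero 2, xT_mem W 2⟩ : W.divisionField 2)⟯).fixingSubgroup,
      (ℚ⟮(⟨4 * delta W two_ne_zero, (delta_mem_and_sq W).1⟩ : W.divisionField 2)⟯).fixingSubgroup, ⊤] :
        Fin 5 → Subgroup (W.divisionField 2 ≃ₐ[ℚ] W.divisionField 2)) i)]
    (g : W.divisionField 2 ≃ₐ[ℚ] W.divisionField 2) :
    (∑ i : Fin 5, ∑ x : (W.divisionField 2 ≃ₐ[ℚ] W.divisionField 2),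
      ∑ h : (![(ℚ⟮(⟨xT W two_ne_zero 0, xT_mem W 0⟩ : W.divisionField 2)⟯).fixingSubgroup,
        (ℚ⟮(⟨xT W two_ne_zero 1, xT_mem W 1⟩ : W.divisionField 2)⟯).fixingSubgroup,
        (ℚ⟮(⟨xT W two_ne_zero 2, xT_mem W 2⟩ : W.divisionField 2)⟯).fixingSubgroup,
        (ℚ⟮(⟨4 * delta W two_ne_zero, (delta_mem_and_sq W).1⟩ : W.divisionField 2)⟯).fixingSubgroup, ⊤] :
          Fin 5 → Subgroup (W.divisionField 2 ≃ₐ[ℚ] W.divisionField 2)) i,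
        (![fun x => if x = 1 then (1 : ℤ) else 0, fun x => if x = 1 then (1 : ℤ) else 0,
            fun x => if x = 1 then (1 : ℤ) else 0, fun x => if x = 1 then (1 : ℤ) else 0,
            fun x => if x = 1 then (-1 : ℤ) else 0] : Fin 5 → (W.divisionField 2 ≃ₐ[ℚ] W.divisionField 2) → ℤ) i x *
          (fun (_ : Fin 5) (y : W.divisionField 2 ≃ₐ[ℚ] W.divisionField 2) => if y = 1 then (1 : ℤ) else 0) i
            (((h : W.divisionField 2 ≃ₐ[ℚ] W.divisionField 2))⁻¹ * x⁻¹ * g)) =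
      if g = 1 then ((3 : ℕ) : ℤ) else 0 :=
  NormRelation.normRelation_card_six (natCard_gal W ht hΔ) _ _ _ _
    (natCard_fixingSubgroup_adjoin_xT W ht hΔ 0) (natCard_fixingSubgroup_adjoin_xT W ht hΔ 1) (natCard_fixingSubgroup_adjoin_xT W ht hΔ 2)
    (fixingSubgroup_adjoin_xT_ne W ht hΔ (by decide)) (fixingSubgroup_adjoin_xT_ne W ht hΔ (by decide))
    (fixingSubgroup_adjoin_xT_ne W ht hΔ (by decide)) (natCard_fixingSubgroup_adjoin_delta W ht hΔ) g

/-! ## §3 `T ∩ ℚ_∞ = ℚ`: the cyclotomic character of `ℚ` stays surjective on `Γ_T` -/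

/-- `T = ℚ(β₀)(δ)`: `δ` generates `T` over the odd-degree subfield `ℚ(β₀)`. [cite: SilvermanAEC2009, III.§1] -/
theorem adjoin_delta_eq_top (ht : ∀ x : ℚ, ¬ HasRationalTwoTorsionX W x) (hΔ : W.Δ < 0) :
    Algebra.adjoin ↥(ℚ⟮(⟨xT W two_ne_zero 0, xT_mem W 0⟩ : W.divisionField 2)⟯)
      {(⟨4 * delta W two_ne_zero, (delta_mem_and_sq W).1⟩ : W.divisionField 2)} = ⊤ := by
  haveI : IsGalois ℚ (W.divisionField 2) := W.isGalois_divisionField 2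
  have hsq : ¬ IsSquare W.Δ := fun ⟨r, hr⟩ ↦ by nlinarith [mul_self_nonneg r]
  set E := ℚ⟮(⟨xT W two_ne_zero 0, xT_mem W 0⟩ : W.divisionField 2)⟯
  set d : W.divisionField 2 := ⟨4 * delta W two_ne_zero, (delta_mem_and_sq W).1⟩
  have hint : IsIntegral E d := IsIntegral.of_finite E d
  rw [← IntermediateField.adjoin_simple_toSubalgebra_of_isAlgebraic hint.isAlgebraic]
  -- `[T : E] = 2`, `d ∉ E`, so `E⟮d⟯ = ⊤`
  have hE3 := finrank_adjoin_xT W ht 0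
  have htower := Module.finrank_mul_finrank ℚ E (W.divisionField 2)
  rw [hE3, finrank_divisionField_two_eq_six W ht hsq] at htower
  have hTE : Module.finrank E (W.divisionField 2) = 2 := by omega
  have hne1 : Module.finrank E E⟮d⟯ ≠ 1 := by
    intro h1
    rw [IntermediateField.finrank_adjoin_simple_eq_one_iff, IntermediateField.mem_bot] at h1
    obtain ⟨e, he⟩ := h1
    apply delta_not_mem_adjoin_xT W ht hΔ 0
    change d ∈ E
    rw [← he]
    exact e.2
  have hdvd : Module.finrank E E⟮d⟯ ∣ 2 := by
    have h := IntermediateField.finrank_bot_mul_relfinrank (le_top : E⟮d⟯ ≤ ⊤)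
    rw [IntermediateField.finrank_top', hTE] at h
    exact Dvd.intro _ h
  have h2 : Module.finrank E E⟮d⟯ = 2 := by
    rcases (Nat.dvd_prime Nat.prime_two).mp hdvd with h | h
    · exact absurd h hne1
    · exact h
  have htop : E⟮d⟯ = ⊤ := by
    apply IntermediateField.eq_of_le_of_finrank_eq le_top
    rw [h2, IntermediateField.finrank_top', hTE]
  rw [htop]
  rfl

/-- **`κ ∘ res : Γ_T → ℤ₂` is onto** for the cyclotomic `κ` of `ℚ` (`T = ℚ(β₀)(√Δ_W)` totally complex over the odd-degree `ℚ(β₀)`, so `√2 ∉ T`).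
[cite: Washington1997, §13.1] -/
theorem surjective_gal_restrict (ht : ∀ x : ℚ, ¬ HasRationalTwoTorsionX W x) (hΔ : W.Δ < 0) (κ : ZpExtension ℚ 2) (hκ : κ.IsCyclotomic) :
    haveI : NumberField (W.divisionField 2) := NumberField.mk
    Function.Surjective (κ.toContinuousMonoidHom.comp (absGaloisRestrict ℚ (W.divisionField 2))) := by
  haveI : NumberField (W.divisionField 2) := NumberField.mk
  haveI := isTotallyComplex_divisionField_two W hΔ
  set E := ℚ⟮(⟨xT W two_ne_zero 0, xT_mem W 0⟩ : W.divisionField 2)⟯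
  haveI : NumberField E := NumberField.mk
  have hodd : Odd (Module.finrank ℚ E) := by rw [finrank_adjoin_xT W ht 0]; decide
  refine surjective_comp_absGaloisRestrict_of_sq_eq_of_isTotallyComplex κ hκ E (W.divisionField 2) hodd
    (x := (⟨4 * delta W two_ne_zero, (delta_mem_and_sq W).1⟩ : W.divisionField 2)) (m := (W.Δ : E)) ?_ (adjoin_delta_eq_top W ht hΔ)
  apply (algebraMap (W.divisionField 2) (AlgebraicClosure ℚ)).injective
  rw [map_pow]
  change (4 * delta W two_ne_zero) ^ 2 = algebraMap (W.divisionField 2) (AlgebraicClosure ℚ) (algebraMap E (W.divisionField 2) (W.Δ : E))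
  rw [map_ratCast, map_ratCast]
  exact (delta_mem_and_sq W).2

end Summit.BirchSwinnertonDyer.BirchSwinnertonDyer.Theorems.AlignedTransportAtTwoSexticNormRelationDescent

end
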